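import Literature.AnabelianGeometry.EtaleTheta.Discharge.Sec4RootTransportTwisted

/-!
# [EtTh] §4 / Thm 5.7: re-normalising the coherent transport datum by a UNIT of `A_N` — absorbing the [FrdI] Prop 5.6
# unit `e₁` of the level-1 producers (R192 sequel (2b), proof-only; answer to abc-iut-w5-d245's note 10:53:03Z)

S. Mochizuki, *The étale theta function and its Frobenioid-theoretic manifestations*, Publ. RIMS **45** (2009)
[cite: MochizukiEtTh2009, Thm 5.7 p.329–330 (PDF pp.103–104); Rmk 4.3.2 p.318–319 (PDF pp.92–93); §5 p.330–331 (PDF pp.104–105)].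

abc-iut cell, layer L2, row R219 (seat abc-iut-f-121).  PROOF-ONLY over `Discharge/Sec4RootTransportTwisted.lean` (p438241).

WHY (abc-iut-w5-d245, 10:53:03Z): abc-iut-L2-d4's chosen-family capstone (p435457) consumes at level 1 the transport
`hstrv₁ : StrvTransport Ψ (αf 1) (ef 1) θ₁` of `s^trv_1`, produced (p437125) for the [FrdI] Prop 5.6 unit `e₁ ∈ O^×(A_1)` — NOT `1`
in general — whereas Prop 4.2 (iv) (`exists_unit_transport_twisted`) hands identifications with `e = 1` relative to the anchors.
A coherent family for the knit is therefore `(a_N ≪≫ ẽ_N, b_N, ef N := ẽ_N⁻¹, D_c := 1, D_p := v·ũ)` for units `ẽ_N ∈ O^×(A_N)`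
COMPATIBLE along the transitions (`α_{1,N} ≫ ẽ_1 = ẽ_N ≫ α_{1,N}` — the A-side twin `hunit₁N` of `hroot₁N`, honest class (A)).
WHAT IS PROVED (pure isomorphism bookkeeping, any category / functor; then the packaged §5 shape):
* `transport_renorm_unit` — `(a ≪≫ ẽ)⁻¹ ≫ F s ≫ b = ẽ⁻¹ ≫ (a⁻¹ ≫ F s ≫ b)`: the `hT`/`hT′` shapes with `e := ẽ.symm`;
* `transition_compat_renorm` — `hΨα` for `(a_N ≪≫ ẽ_N, a_1 ≪≫ ẽ_1)` from `hΨα` for `(a_N, a_1)` and `t ≫ ẽ_1 = ẽ_N ≫ t`;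
* `he_renorm` — `he` for `(ef N, ef 1) := (ẽ_N.symm, ẽ_1.symm)` from the same compatibility;
* `NthRoot.exists_unit_transport_twisted_renorm` — `exists_unit_transport_twisted` re-normalised by a given unit `ẽ` of `A_N`:
  `(a′, b, e := ẽ.symm, D_c := 1, D_p := v·ũ)` with `a′⁻¹ ≫ Ψ α ≫ eA = ẽ⁻¹ ≫ α`, `b⁻¹ ≫ Ψ β ≫ eB = β`, `Base(a′ ≪≫ ẽ.symm) = ebs⁻¹`.
HONEST FRAMING: kernel-checked bookkeeping; the unit lifts `ẽ_N` over `e₁` are INPUTS (Lemma 5.8 / Def 4.1 (iii) class, like `hroot₁N`);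
refereed pre-IUT material; nothing here bears on [IUTchIII] Cor. 3.12 or takes a side; typed ≠ proved for any genuine datum.
-/

namespace Literature.AnabelianGeometry.EtaleTheta

open CategoryTheory Opposite Literature.AlgebraicGeometry.Frobenioids

namespace BiKummerSetting

namespace NthRoot

/-! ### §1. Isomorphism bookkeeping (any category, any functor) -/

/-- **Re-normalising an identification by an automorphism of the source**: `(a ≪≫ ẽ)⁻¹ ≫ F s ≫ b = ẽ⁻¹ ≫ (a⁻¹ ≫ F s ≫ b)` — so a
transport equation `a⁻¹ ≫ F s ≫ b = s ≫ D` becomes `(a ≪≫ ẽ)⁻¹ ≫ F s ≫ b = ẽ.symm ≫ s ≫ D`, the `hT` shape with `e := ẽ.symm`.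
[cite: MochizukiEtTh2009, Thm 5.7 p.330 (PDF p.104)] -/
theorem transport_renorm_unit {C' : Type*} [Category C'] (F : C' ⥤ C') {X Y : C'} (a : F.obj X ≅ X) (b : F.obj Y ≅ Y)
    (et : X ≅ X) (s : X ⟶ Y) (D : Aut Y) (h : a.inv ≫ F.map s ≫ b.hom = s ≫ D.hom) :
    (a ≪≫ et).inv ≫ F.map s ≫ b.hom = et.symm.hom ≫ s ≫ D.hom := by
  rw [Iso.trans_inv, Category.assoc, h, Iso.symm_hom]

/-- **`hΨα`/`hΨβ` after re-normalisation**: if `aN⁻¹ ≫ F t ≫ a1 = t` and the units are compatible along `t`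
(`t ≫ ẽ1 = ẽN ≫ t`), then `(aN ≪≫ ẽN)⁻¹ ≫ F t ≫ (a1 ≪≫ ẽ1) = t`. [cite: MochizukiEtTh2009, Rmk 4.3.2 p.318–319 (PDF pp.92–93)] -/
theorem transition_compat_renorm {C' : Type*} [Category C'] (F : C' ⥤ C') {XN X1 : C'} (aN : F.obj XN ≅ XN)
    (a1 : F.obj X1 ≅ X1) (etN : XN ≅ XN) (et1 : X1 ≅ X1) (t : XN ⟶ X1) (h : aN.inv ≫ F.map t ≫ a1.hom = t)
    (ht : t ≫ et1.hom = etN.hom ≫ t) : (aN ≪≫ etN).inv ≫ F.map t ≫ (a1 ≪≫ et1).hom = t := by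
  rw [Iso.trans_inv, Iso.trans_hom, Category.assoc, ← Category.assoc (F.map t), ← Category.assoc aN.inv,
    ← Category.assoc aN.inv, Category.assoc aN.inv, h, ht, etN.inv_hom_id_assoc]

/-- **`he` after re-normalisation**: with `ef N := ẽN.symm`, `ef 1 := ẽ1.symm`, the compatibility `t ≫ ẽ1 = ẽN ≫ t` gives
`t ≫ (ef 1).hom = (ef N).hom ≫ t`. [cite: MochizukiEtTh2009, Rmk 4.3.2 p.318–319 (PDF pp.92–93)] -/
theorem he_renorm {C' : Type*} [Category C'] {XN X1 : C'} (etN : XN ≅ XN) (et1 : X1 ≅ X1) (t : XN ⟶ X1)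
    (ht : t ≫ et1.hom = etN.hom ≫ t) : t ≫ et1.symm.hom = etN.symm.hom ≫ t := by
  rw [Iso.symm_hom, Iso.symm_hom, Iso.eq_inv_comp, ← Category.assoc, ← ht, Category.assoc, et1.hom_inv_id,
    Category.comp_id]

/-! ### §2. The §5 per-level datum re-normalised by a unit of `A_N` -/

section

universe u₀ v₀ u v w

variable {K : Type u₀} [Field K] {D₀ : Type u₀} [Category.{v₀} D₀] {V : FrdIMonoidStub.{w}}
  {X₁ : SemiGraphs.TemperedArithmeticGroup.{u₀} K} {T₁ : RealifiedDivisorMonoids (D₀ := D₀) V}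
  {D₁ : Type u} [Category.{v} D₁] {VD₁ : FrdICatStub.{u, v, w} D₁} {S : BiKummerSetting X₁ T₁ D₁ VD₁}
  (h : Thm44Hyp S S) (ψ : ∀ A : S.C, S.biratUnits A ≃* S.biratUnits (h.Ψ.functor.obj A))
    (pullFrac : ∀ {A A' : S.C} (_ : A' ⟶ A), S.biratUnits A → S.biratUnits A')
    (hpull : ∀ {A A' : S.C} (φ : A' ⟶ A) (f : S.biratUnits A),
      ψ A' (pullFrac φ f) = pullFrac (h.Ψ.functor.map φ) (ψ A f))
    (hii : Thm44_ii h ψ) (h3 : h.PreservesFrobeniusStructure) (h4b : h.PreservesBaseFrobeniusTypeData)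
    (h8 : h.PreservesAmple) (h15a : h.PreservesFixedByHA ψ) (h15 : h.PreservesSaturated ψ)
    {A B : S.C} {f : S.biratUnits A} {P : S.FractionPair f B} {N : ℕ+} (R : S.NthRoot f P N pullFrac)
    (u : Aut B) (hu : u ∈ S.units B) {f' : S.biratUnits A}
    (hfrac : S.fracOf P.num (P.den ≫ u.hom) P.isPreStep_num (S.isPreStep_comp_aut P.isPreStep_den u)
      (S.baseEquivalent_comp_unit P.base_eq hu) = f')
    (hdisj : S.DisjointSupports (S.div P.num) (S.div (P.den ≫ u.hom)))
    (eA : h.Ψ.functor.obj A ≅ A) (eB : h.Ψ.functor.obj B ≅ B)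
    (hnum : eA.inv ≫ h.Ψ.functor.map P.num ≫ eB.hom = P.num)
    (hden : eA.inv ≫ h.Ψ.functor.map P.den ≫ eB.hom = P.den ≫ u.hom)
    (hf : pullFrac eA.hom f' = ψ A f) (heA : S.IsIsometry eA.hom) (heB : S.IsIsometry eB.hom)
    (hArises : S.ArisesFromBaseFrobeniusPair (R.αData.G.map (h.Ψ.functor.mapAut R.AN))
      (h.Ψ.functor.map R.αData.α₂) (h.Ψ.functor.map R.αData.α₁ ≫ eA.hom))
    (hpull₂ : ∀ {X Y Z : S.C} (φ : X ⟶ Y) (χ : Y ⟶ Z) (g : S.biratUnits Z),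
      pullFrac (φ ≫ χ) g = pullFrac φ (pullFrac χ g))
    (ut : Aut R.BN) (hut : ut ∈ S.units R.BN) (hover : ut.hom ≫ R.β = R.β ≫ u.hom)
    {root' : S.biratUnits R.AN}
    (hfracN : S.fracOf R.pair.num (R.pair.den ≫ ut.hom) R.pair.isPreStep_num
      (S.isPreStep_comp_aut R.pair.isPreStep_den ut) (S.baseEquivalent_comp_unit R.pair.base_eq hut) = root')
    (hdisjN : S.DisjointSupports (S.div R.pair.num) (S.div (R.pair.den ≫ ut.hom)))
    (hpow : root' ^ (N : ℕ) = pullFrac R.αData.α₁ f')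
    (hsat : S.IsSaturated R.AN N (pullFrac R.αData.α₁ f'))
    (hivP' : ∀ (R₁ R₂ : S.NthRoot f' (P.twistUnit u hu hfrac hdisj) N pullFrac)
      (ebs : S.base.obj R₁.AN ≅ S.base.obj R₂.AN), S.base.map R₁.α = ebs.hom ≫ S.base.map R₂.α →
        ∃ (v : S.mu R₁.BN N) (ζA : R₁.AN ≅ R₂.AN) (ζB : R₁.BN ≅ R₂.BN),
          ζA.hom ≫ R₂.pair.num = R₁.pair.num ≫ ζB.hom ∧
          ζA.hom ≫ R₂.pair.den = (R₁.pair.den ≫ (v : Aut R₁.BN).hom) ≫ ζB.hom ∧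
          ζA.hom ≫ R₂.α = R₁.α ∧ ζB.hom ≫ R₂.β = R₁.β ∧ S.base.mapIso ζA = ebs)
    (ebs : S.base.obj R.AN ≅ S.base.obj (h.Ψ.functor.obj R.AN))
    (hebs : S.base.map R.α = ebs.hom ≫ S.base.map (h.Ψ.functor.map R.α ≫ eA.hom))
    (et : Aut R.AN)

include ψ hpull hii h3 h4b h8 h15a h15 hfrac hdisj hnum hden hf heA heB hArises hpull₂ hut hover hfracN hdisjN hpow hsat hivP' hebs in
/-- **The coherent per-level datum RE-NORMALISED by a unit `ẽ` of `A_N`** (to absorb the [FrdI] Prop 5.6 unit of the level-1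
producers): `(a′ := a ≪≫ ẽ, b, e := ẽ.symm, D_c := 1, D_p := v·ũ)` with `hT : a′⁻¹ ≫ Ψ s′_N ≫ b = e ≫ s′_N ≫ D_c`,
`hT′ : a′⁻¹ ≫ Ψ s″_N ≫ b = e ≫ s″_N ≫ D_p`, `D_c⁻¹·D_p ∈ O^×(B_N)`, and the base-pair compatibility in the form
`a′⁻¹ ≫ Ψ α ≫ eA = ẽ⁻¹ ≫ α`, `b⁻¹ ≫ Ψ β ≫ eB = β`, `Base(a′ ≪≫ ẽ.symm) = ebs⁻¹` (feed `transition_compat_renorm` / `he_renorm`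
with units compatible along the transitions). [cite: MochizukiEtTh2009, Thm 5.7 p.330 (PDF p.104); Rmk 4.3.2 p.318–319 (PDF pp.92–93)] -/
theorem exists_unit_transport_twisted_renorm :
    ∃ (a' : h.Ψ.functor.obj R.AN ≅ R.AN) (b : h.Ψ.functor.obj R.BN ≅ R.BN) (Dp : Aut R.BN),
      a'.inv ≫ h.Ψ.functor.map R.pair.num ≫ b.hom = et.symm.hom ≫ R.pair.num ≫ (1 : Aut R.BN).hom ∧
      a'.inv ≫ h.Ψ.functor.map R.pair.den ≫ b.hom = et.symm.hom ≫ R.pair.den ≫ Dp.hom ∧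
      (1 : Aut R.BN)⁻¹ * Dp ∈ S.units R.BN ∧ (∃ v ∈ S.mu R.BN N, Dp = v * ut) ∧
      a'.inv ≫ h.Ψ.functor.map R.α ≫ eA.hom = et.inv ≫ R.α ∧ b.inv ≫ h.Ψ.functor.map R.β ≫ eB.hom = R.β ∧
      S.base.mapIso (a' ≪≫ et.symm) = ebs.symm := by
  obtain ⟨a, b, v, hv, hα, hβ, hn, hd, hbs⟩ := exists_coherent_transport_twisted h ψ pullFrac hpull hii h3 h4b h8 h15a h15 R
    u hu hfrac hdisj eA eB hnum hden hf heA heB hArises hpull₂ ut hut hover hfracN hdisjN hpow hsat hivP' ebs hebs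
  refine ⟨a ≪≫ et, b, v * ut, ?_, ?_, ?_, ⟨v, hv, rfl⟩, ?_, hβ, ?_⟩
  · refine transport_renorm_unit h.Ψ.functor a b et R.pair.num 1 ?_
    rw [hn]
    exact (Category.comp_id _).symm
  · refine transport_renorm_unit h.Ψ.functor a b et R.pair.den (v * ut) ?_
    rw [hd, Category.assoc, Aut.Aut_mul_def, Iso.trans_hom]
  · rw [inv_one, one_mul]
    exact (S.units R.BN).mul_mem hv.1 hut
  · rw [Iso.trans_inv, Category.assoc, hα]
  · rw [Iso.trans_assoc, Iso.self_symm_id, Iso.trans_refl]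
    exact hbs

end

end NthRoot

end BiKummerSetting

end Literature.AnabelianGeometry.EtaleTheta
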